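import Summits.BirchSwinnertonDyer.Rank1Residual.X11b.WeakLeopoldt
import HarnessLib

/-!
# Crux `AnticycControlAdditiveK` (route `SchneiderFreeAdditiveX3`, item stmt-BirchSwinnertonDyer-19295),
# atom (L10) on regime B2 (`E(K)[p] ≠ 0`) — part 1: `H²(Γ_K, E[p^∞])` is finite and VANISHES
# WITHOUT the global no-`p`-torsion hypothesis

Seat `bsd-schneider-door-c6` (cell `bsd-schneider-ideate`). Route R1's weak-Leopoldt file
(`X11b.WeakLeopoldt`, sub-cell multr1-p1 gen 16) bounds `#Ш²(K, E[p^k])` UNIFORMLY in `k` by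
`#Sel_𝔭^Σ(K, E[p^∞])` through the INJECTIVITY of `H¹(ι_k) : H¹(K, E[p^k]) → H¹(K, E[p^∞])`
(`ShaBound.natCard_sha_torsion_le_selmerAcBase`, hypothesis `hΓ : E(K̄)[p^∞]^{Γ_K} = 0`), and deduces
`H²(Γ_K, E[p^∞]) = 0` (finite, `p`-primary, `p`-divisible). On regime B2 (`E(K)[p] ≠ 0`) injectivity
fails, but its KERNEL is small: it consists of the Kummer connecting classes `δ(b)`, `p^k b ∈ E(K)[p^∞]`
(the tree's `Levels.map_primaryInclusion_eq_zero_iff`), and `δ(b)` depends only on `p^k b`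
(`connectingClass_eq_of_nsmul_eq`), so `#ker H¹(ι_k) ≤ #E(K̄)[p^∞]^{Γ_K}` — FINITE, uniformly in `k`.
Hence `#Ш¹(K, E[p^k]) ≤ #Sel · #E(K̄)[p^∞]^{Γ_K}` and the whole chain runs with this bound:

* `connectingClass_eq_of_nsmul_eq`, `natCard_ker_map_primaryInclusion_le`;
* `natCard_sha_torsion_le_anyTorsion`, `natCard_shaTwo_torsion_le_anyTorsion`;
* `finite_galoisCohomology_two_primary_anyTorsion`, **`subsingleton_galoisCohomology_two_primary_anyTorsion`**
  — `H²(Γ_K, E[p^∞]) = 0` for `K` totally complex, GIVEN the cited `poitouTate_sha_tateDual K`,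
  `cd_p K ≤ 2`, the finiteness of Castella's `Sel_𝔭^Σ(K, E[p^∞])`, uniform local exponents, and the
  finiteness of `E(K̄)[p^∞]^{Γ_K}` (a tree theorem, `finite_fixedPoints_geomPrimaryTorsion`) — NO
  `E(K)[p] = 0` (multr1-p1's proofs VERBATIM otherwise; credit multr1-p1).

CONDITIONAL on the cited fact (hypothesis BY NAME); no `Prop` fact minted; closes nothing by itself;
BSD is not proved by any of this. Part 2 (`…CoinvAnyTorsion.lean`) feeds this into (L10).

References: [JetchevSkinnerWan2017] Lemma 3.3.3 (arXiv:1512.06894 p. 12); [Harari2020] Thm. 17.13 (b);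
[GreenbergLNM1716] §2 p. 63, §5 proof of Prop. 5.8; [SerreGaloisCohomology1997] II §4.4 Prop. 13.
-/

noncomputable section

open scoped Classical

open CategoryTheory Field NumberField IsDedekindDomain
open Literature.NumberTheory.EllipticCurves
open Literature.NumberTheory.GaloisRepresentations
open Literature.NumberTheory.GaloisRepresentations.DiscreteGaloisModule
open Literature.NumberTheory.GaloisCohomology
open scoped ContRepresentation

set_option linter.dupNamespace false

namespace Summit.BirchSwinnertonDyer.BirchSwinnertonDyer.Theorems.SchneiderFreeAdditiveX3

open Summit.BirchSwinnertonDyer.Rank1Residual.X11b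
open Summit.BirchSwinnertonDyer.Rank1Residual.X11b.Levels
open Summit.BirchSwinnertonDyer.Rank1Residual.X11b.ShaBound
open Summit.BirchSwinnertonDyer.Rank1Residual.X11b.WeakLeopoldt

/-! ## §1. The kernel of `H¹(K, E[p^k]) → H¹(K, E[p^∞])` is at most `#E(K̄)[p^∞]^{Γ_K}` -/

section Kernel

universe u

variable {F : Type u} [Field F] {A B : Type u} [AddCommGroup A] [TopologicalSpace A]
  [DiscreteTopology A] [AddCommGroup B] [TopologicalSpace B] [DiscreteTopology B]
  {ρA : DiscreteGaloisModule F A} {ρB : DiscreteGaloisModule F B}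

/-- **`δ(b)` depends only on `n • b`**: for `i : A ↪ B` injective with `range i ⊇ B[n]`, if
`n • b = n • b'` then `b − b' = i a` and the two connecting cocycles differ by the coboundary of `a`.
Silverman, *AEC*, VIII.§2 (the Kummer connecting map is defined on `B^{Γ}` via `n`-th roots). [folklore] -/
theorem connectingClass_eq_of_nsmul_eq {i : ρA.toContRepresentation →ⁱL ρB.toContRepresentation} {n : ℕ}
    {hrange : ∀ b : B, n • b = 0 → ∃ a : A, i a = b} (hinj : Function.Injective i) (b b' : B)
    (hb : ∀ σ : absoluteGaloisGroup F, ρB σ (n • b) = n • b)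
    (hb' : ∀ σ : absoluteGaloisGroup F, ρB σ (n • b') = n • b') (h : n • b = n • b') :
    connectingClass i n hrange hinj b hb = connectingClass i n hrange hinj b' hb' := by
  obtain ⟨a, ha⟩ := hrange (b - b') (by rw [smul_sub, h, sub_self])
  have h' : ∀ σa : absoluteGaloisGroup F, i (ρA.toTopRep.ρ σa a) = ρB σa (i a) := fun σa ↦
    i.isIntertwining σa a
  have key : oneCocycleClass ρA.toTopRep
      (liftCocycle i n hrange hinj (Levels.cobCocycle ρB b) (nsmul_cobCocycle_apply_eq_zero n hb) -
        liftCocycle i n hrange hinj (Levels.cobCocycle ρB b') (nsmul_cobCocycle_apply_eq_zero n hb')) =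
      0 := by
    refine (oneCocycleClass_eq_zero_iff _ _).mpr ⟨a, fun σ ↦ hinj ?_⟩
    change i ((liftCocycle i n hrange hinj (Levels.cobCocycle ρB b)
        (nsmul_cobCocycle_apply_eq_zero n hb)).1 σ -
      (liftCocycle i n hrange hinj (Levels.cobCocycle ρB b') (nsmul_cobCocycle_apply_eq_zero n hb')).1 σ) =
      i (ρA.toTopRep.ρ σ a - a)
    rw [map_sub, apply_liftCocycle hinj, apply_liftCocycle hinj, Levels.cobCocycle_apply,
      Levels.cobCocycle_apply, map_sub, h', ha, map_sub]
    abel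
  rw [oneCocycleClass_sub, sub_eq_zero] at key
  exact key

end Kernel

section KernelCurve

variable {K : Type} [Field K] [NumberField K] (W : WeierstrassCurve K) [W.IsElliptic] (p k : ℕ)
  [Fact p.Prime]

/-- **`#ker (H¹(K, E[p^k]) → H¹(K, E[p^∞])) ≤ #E(K̄)[p^∞]^{Γ_K}`** (and the kernel is finite): every kernel
class is `δ(b)` with `R = p^k b` invariant (`Levels.map_primaryInclusion_eq_zero_iff`), `δ(b)` depends
only on `R` (`connectingClass_eq_of_nsmul_eq`), and every invariant `R` has a `p^k`-th root in `E[p^∞]`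
(divisibility): `R ↦ δ(b_R)` is onto the kernel. `E(K̄)[p^∞]^{Γ_K}` is finite (tree theorem
`finite_fixedPoints_geomPrimaryTorsion`). [cite: GreenbergLNM1716, §2 p. 63 and §5 proof of Prop. 5.8] -/
theorem natCard_ker_map_primaryInclusion_le :
    Finite (galoisCohomology.map (primaryInclusion W p k) 1).ker ∧
      Nat.card (galoisCohomology.map (primaryInclusion W p k) 1).ker ≤
        Nat.card {m : W.geomPrimaryTorsion p | ∀ σ : absoluteGaloisGroup K, σ • m = m} := by
  have hdiv : W.zsmul_geomPoints_surjective := W.zsmul_geomPoints_surjective_holds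
  haveI : Finite {m : W.geomPrimaryTorsion p | ∀ σ : absoluteGaloisGroup K, σ • m = m} :=
    (W.finite_fixedPoints_geomPrimaryTorsion p).to_subtype
  -- a `p^k`-th root of each invariant point, and its connecting class
  have hroot : ∀ R : {m : W.geomPrimaryTorsion p | ∀ σ : absoluteGaloisGroup K, σ • m = m},
      ∃ b : W.geomPrimaryTorsion p, p ^ k • b = (R : W.geomPrimaryTorsion p) := fun R ↦
    exists_pow_nsmul_eq_geomPrimaryTorsion W p k hdiv _
  choose root hroot using hroot
  have hfix : ∀ R : {m : W.geomPrimaryTorsion p | ∀ σ : absoluteGaloisGroup K, σ • m = m},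
      ∀ σ : absoluteGaloisGroup K,
        LocBridge.primaryGaloisModule W p σ (p ^ k • root R) = p ^ k • root R := fun R σ ↦ by
    rw [hroot R]; exact R.2 σ
  let ψ : {m : W.geomPrimaryTorsion p | ∀ σ : absoluteGaloisGroup K, σ • m = m} →
      (galoisCohomology.map (primaryInclusion W p k) 1).ker := fun R ↦
    ⟨connectingClass (primaryInclusion W p k) (p ^ k) (exists_primaryInclusion_eq_of_nsmul_eq_zero W p k)
        (primaryInclusion_injective W p k) (root R) (hfix R),
      (AddMonoidHom.mem_ker).2 (map_connectingClass (primaryInclusion_injective W p k) _ (hfix R))⟩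
  have hψ : Function.Surjective ψ := by
    rintro ⟨c, hc⟩
    obtain ⟨b, hb, hcb⟩ := (map_primaryInclusion_eq_zero_iff W p k c).mp ((AddMonoidHom.mem_ker).1 hc)
    refine ⟨⟨p ^ k • b, (fun σ ↦ hb σ : ∀ σ : absoluteGaloisGroup K, σ • (p ^ k • b) = p ^ k • b)⟩,
      Subtype.ext ?_⟩
    exact (connectingClass_eq_of_nsmul_eq (primaryInclusion_injective W p k) _ b (hfix _) hb
      (hroot _)).trans hcb.symm
  exact ⟨Finite.of_surjective ψ hψ, Nat.card_le_card_of_surjective ψ hψ⟩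

end KernelCurve

/-! ## §2. `#Ш¹(K, E[p^k]) ≤ #Sel_𝔭^Σ(K, E[p^∞]) · #E(K̄)[p^∞]^{Γ_K}` and the bound on `#Ш²(K, E[p^k])` -/

section Level

variable {K : Type} [Field K] [NumberField K] (W : WeierstrassCurve K) [W.IsElliptic]
  (p : ℕ) [Fact p.Prime] (k : ℕ) (𝔭 : HeightOneSpectrum (𝓞 K))

/-- **`#Ш¹(K, E[p^k]) ≤ #Sel_𝔭^Σ(K, E[p^∞]) · #E(K̄)[p^∞]^{Γ_K}`** whenever Castella's Selmer group over
`K` is finite — NO `E(K)[p] = 0`: the restriction `g` of `H¹(ι_k)` to `Ш¹(K, E[p^k])` has range inside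
`Sel_𝔭^Σ(K, E[p^∞])` (`map_mem_sha`, `sha_le_selmerGroup`, `topEquivH1_mem_selmerAcBase_iff`) and
kernel inside `ker H¹(ι_k)` (`natCard_ker_map_primaryInclusion_le`); `#Ш¹ = #range g · #ker g`.
multr1-p1's `natCard_sha_torsion_le_selmerAcBase` is the case `E(K̄)[p^∞]^{Γ_K} = 0`.
[cite: Castella2018, Def. 2.2 (arXiv:1704.06608 p. 5)] [cite: GreenbergLNM1716, §2 p. 63] -/
theorem natCard_sha_torsion_le_anyTorsion (S : Set (HeightOneSpectrum (𝓞 K)))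
    [Finite (AcSelmer.selmerAcBase W p 𝔭 S)] :
    Finite (sha (W.torsionGaloisModule ((p ^ k : ℕ) : ℤ))) ∧
      Nat.card (sha (W.torsionGaloisModule ((p ^ k : ℕ) : ℤ))) ≤
        Nat.card (AcSelmer.selmerAcBase W p 𝔭 S) *
          Nat.card {m : W.geomPrimaryTorsion p | ∀ σ : absoluteGaloisGroup K, σ • m = m} := by
  let g : sha (W.torsionGaloisModule ((p ^ k : ℕ) : ℤ)) →+
      galoisCohomology (LocBridge.primaryGaloisModule W p) 1 :=
    (galoisCohomology.map (primaryInclusion W p k) 1).comp (sha _).subtype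
  have hgapply : ∀ x : sha (W.torsionGaloisModule ((p ^ k : ℕ) : ℤ)),
      g x = galoisCohomology.map (primaryInclusion W p k) 1 (x : _) := fun _ ↦ rfl
  -- the range embeds into Castella's Selmer group
  let f : g.range → AcSelmer.selmerAcBase W p 𝔭 S := fun y ↦
    ⟨LocBridge.topEquivH1 (LocBridge.isOpen_stabilizer_geomPrimaryTorsion W p) y.1, by
      obtain ⟨x, hx⟩ := y.2
      rw [AcSelmer.topEquivH1_mem_selmerAcBase_iff, ← hx, hgapply]
      exact sha_le_selmerGroup _ _ (map_mem_sha _ x.2)⟩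
  have hf : Function.Injective f := fun y₁ y₂ h ↦ by
    apply Subtype.ext
    apply (LocBridge.topEquivH1 (LocBridge.isOpen_stabilizer_geomPrimaryTorsion W p)).injective
    exact congrArg Subtype.val h
  haveI hfinr : Finite g.range := Finite.of_injective f hf
  have hcardr : Nat.card g.range ≤ Nat.card (AcSelmer.selmerAcBase W p 𝔭 S) :=
    Nat.card_le_card_of_injective f hf
  -- the kernel embeds into `ker H¹(ι_k)`
  obtain ⟨hfinK, hcardK⟩ := natCard_ker_map_primaryInclusion_le W p k
  haveI := hfinK
  let e : g.ker → (galoisCohomology.map (primaryInclusion W p k) 1).ker := fun x ↦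
    ⟨x.1.1, (AddMonoidHom.mem_ker).2 (by
      have h2 : g x.1 = 0 := (AddMonoidHom.mem_ker).1 x.2
      rwa [hgapply] at h2)⟩
  have he : Function.Injective e := fun x₁ x₂ h ↦ by
    have h' := congrArg Subtype.val h
    apply Subtype.ext; apply Subtype.ext
    exact h'
  haveI hfink : Finite g.ker := Finite.of_injective e he
  have hcardk : Nat.card g.ker ≤
      Nat.card {m : W.geomPrimaryTorsion p | ∀ σ : absoluteGaloisGroup K, σ • m = m} :=
    (Nat.card_le_card_of_injective e he).trans hcardK
  -- `#Ш¹ = #range · #ker`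
  have hcard : Nat.card (sha (W.torsionGaloisModule ((p ^ k : ℕ) : ℤ))) =
      Nat.card g.range * Nat.card g.ker := by
    rw [← AddSubgroup.index_ker g, AddSubgroup.index_mul_card]
  have hne : Nat.card (sha (W.torsionGaloisModule ((p ^ k : ℕ) : ℤ))) ≠ 0 := by
    rw [hcard]; exact mul_ne_zero Nat.card_pos.ne' Nat.card_pos.ne'
  exact ⟨Nat.finite_of_card_ne_zero hne, hcard ▸ Nat.mul_le_mul hcardr hcardk⟩

/-- **`#Ш²(K, E[p^k]) ≤ #Sel_𝔭^Σ(K, E[p^∞]) · #E(K̄)[p^∞]^{Γ_K}` for every `k ≥ 1`** — NO `E(K)[p] = 0`: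
`#Ш²(K, E[p^k]) = #Ш¹(K, E[p^k]^D) ≤ #Ш¹(K, E[p^k])` (cited Poitou–Tate duality for `Ш`, Weil transport)
and `natCard_sha_torsion_le_anyTorsion`. [cite: JetchevSkinnerWan2017, Lemma 3.3.3 (arXiv:1512.06894 p. 12)]
[cite: Harari2020, Thm. 17.13 (b)] -/
theorem natCard_shaTwo_torsion_le_anyTorsion (hPT : poitouTate_sha_tateDual K) (hk : k ≠ 0)
    (S : Set (HeightOneSpectrum (𝓞 K))) [Finite (AcSelmer.selmerAcBase W p 𝔭 S)] :
    Finite (shaTwo (W.torsionGaloisModule ((p ^ k : ℕ) : ℤ))) ∧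
      Nat.card (shaTwo (W.torsionGaloisModule ((p ^ k : ℕ) : ℤ))) ≤
        Nat.card (AcSelmer.selmerAcBase W p 𝔭 S) *
          Nat.card {m : W.geomPrimaryTorsion p | ∀ σ : absoluteGaloisGroup K, σ • m = m} := by
  have hprime : p.Prime := Fact.out
  haveI : NeZero (p ^ k) := ⟨pow_ne_zero k hprime.ne_zero⟩
  haveI : Finite (W.geomTorsion ((p ^ k : ℕ) : ℤ)) :=
    W.finite_torsionPoints_holds (AlgebraicClosure K) (by exact_mod_cast pow_ne_zero k hprime.ne_zero)
  have h2 : 2 ≤ p ^ k :=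
    le_trans hprime.two_le (by simpa using Nat.pow_le_pow_right hprime.pos (Nat.one_le_iff_ne_zero.2 hk))
  obtain ⟨hfin2, -, hcard⟩ := natCard_shaTwo_eq_natCard_sha_tateDual hPT (p ^ k)
    (W.torsionGaloisModule ((p ^ k : ℕ) : ℤ)) (fun T ↦ AddSubgroup.torsionBy.nsmul T)
  obtain ⟨hfin1, hle⟩ := natCard_sha_torsion_le_anyTorsion W p k 𝔭 S
  haveI := hfin1
  exact ⟨hfin2, hcard ▸ (natCard_sha_tateDual_le W (p ^ k) h2).trans hle⟩

end Level

/-! ## §3. `H²(Γ_K, E[p^∞])` is finite and vanishes, without `E(K)[p] = 0` -/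

section Main

variable {K : Type} [Field K] [NumberField K] (W : WeierstrassCurve K) [W.IsElliptic]
  (p : ℕ) [Fact p.Prime] (𝔭 : HeightOneSpectrum (𝓞 K)) (S : Set (HeightOneSpectrum (𝓞 K)))

/-- **`H²(Γ_K, E[p^∞])` is finite** (of order at most `#Sel_𝔭^Σ(K, E[p^∞]) · #E(K̄)[p^∞]^{Γ_K}`), NO
`E(K)[p] = 0`: every finite set of classes lifts to a single `Ш²(K, E[p^M])` (multr1-p1's
`exists_mem_shaTwo_map_eq`), bounded by `natCard_shaTwo_torsion_le_anyTorsion` (proof otherwise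
multr1-p1's VERBATIM). [cite: JetchevSkinnerWan2017, Lemma 3.3.3 (arXiv:1512.06894 p. 12)]
[cite: Harari2020, Thm. 17.13 (b)] -/
theorem finite_galoisCohomology_two_primary_anyTorsion [IsTotallyComplex K]
    (hPT : poitouTate_sha_tateDual K) [Finite (AcSelmer.selmerAcBase W p 𝔭 S)]
    (htor : ∀ v : HeightOneSpectrum (𝓞 K), ∃ e : ℕ,
      ∀ (j : ℕ) (Q : (W.baseChange (v.adicCompletion K)).toAffine.Point),
        p ^ j • Q = 0 → p ^ e • Q = 0) :
    Finite (galoisCohomology (LocBridge.primaryGaloisModule W p) 2) := by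
  set B := Nat.card (AcSelmer.selmerAcBase W p 𝔭 S) *
    Nat.card {m : W.geomPrimaryTorsion p | ∀ σ : absoluteGaloisGroup K, σ • m = m} with hB
  have key : ∀ s : Finset (galoisCohomology (LocBridge.primaryGaloisModule W p) 2), s.card ≤ B := by
    intro s
    choose M hM0 z hzsha hz using fun Z : galoisCohomology (LocBridge.primaryGaloisModule W p) 2 ↦
      exists_mem_shaTwo_map_eq W p htor Z
    have hML : ∀ Z ∈ s, M Z ≤ s.sup M + 1 := fun Z hZ ↦ (Finset.le_sup hZ).trans (Nat.le_succ _)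
    obtain ⟨hfinL, hcardL⟩ := natCard_shaTwo_torsion_le_anyTorsion W p (s.sup M + 1) 𝔭 hPT
      (Nat.succ_ne_zero _) S
    haveI := hfinL
    haveI := Fintype.ofFinite (shaTwo (W.torsionGaloisModule ((p ^ (s.sup M + 1) : ℕ) : ℤ)))
    let g : shaTwo (W.torsionGaloisModule ((p ^ (s.sup M + 1) : ℕ) : ℤ)) →
        galoisCohomology (LocBridge.primaryGaloisModule W p) 2 :=
      fun y ↦ galoisCohomology.map (Levels.primaryInclusion W p (s.sup M + 1)) 2 y
    have hsub : s ⊆ Finset.univ.image g := by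
      intro Z hZ
      rw [Finset.mem_image]
      refine ⟨⟨galoisCohomology.map (W.torsionInclusion (pow_dvd_pow_cast p (hML Z hZ))) 2 (z Z),
        map_torsionInclusion_mem_shaTwo W p (hML Z hZ) (hzsha Z)⟩, Finset.mem_univ _, ?_⟩
      change galoisCohomology.map (Levels.primaryInclusion W p (s.sup M + 1)) 2
        (galoisCohomology.map (W.torsionInclusion (pow_dvd_pow_cast p (hML Z hZ))) 2 (z Z)) = Z
      rw [map_primaryInclusion_map_torsionInclusion W p (hML Z hZ), hz]
    calc s.card ≤ (Finset.univ.image g).card := Finset.card_le_card hsub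
      _ ≤ Finset.univ.card := Finset.card_image_le
      _ = Nat.card (shaTwo (W.torsionGaloisModule ((p ^ (s.sup M + 1) : ℕ) : ℤ))) := by
          rw [Finset.card_univ, Nat.card_eq_fintype_card]
      _ ≤ B := hcardL
  by_contra hinf
  rw [not_finite_iff_infinite] at hinf
  obtain ⟨t, -, ht⟩ :=
    (Set.infinite_univ (α := galoisCohomology (LocBridge.primaryGaloisModule W p) 2)
    ).exists_subset_card_eq (B + 1)
  have := key t
  omega

/-- **`H²(Γ_K, E[p^∞]) = 0`, NO `E(K)[p] = 0`** — for `K` totally complex, `Sel_𝔭^Σ(K, E[p^∞])` finite,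
uniform `p`-power exponents of `E(K_v)[p^∞]` at the finite places, and the cited facts
`poitouTate_sha_tateDual K`, `FieldCdLE K p 2`: finite (`finite_galoisCohomology_two_primary_anyTorsion`),
`p`-primary and `p`-divisible (multr1-p1's `exists_pow_smul_eq_zero`, `exists_smul_eq`), hence trivial
(multr1-p1's `subsingleton_galoisCohomology_two_primary` VERBATIM with the new finiteness).
[cite: JetchevSkinnerWan2017, Lemma 3.3.3 (arXiv:1512.06894 pp. 11–12)]
[cite: Harari2020, Thm. 17.13 (b)] [cite: SerreGaloisCohomology1997, II §4.4 Prop. 13] -/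
theorem subsingleton_galoisCohomology_two_primary_anyTorsion [IsTotallyComplex K]
    (hPT : poitouTate_sha_tateDual K) (hcd : FieldCdLE K p 2)
    [Finite (AcSelmer.selmerAcBase W p 𝔭 S)]
    (htor : ∀ v : HeightOneSpectrum (𝓞 K), ∃ e : ℕ,
      ∀ (j : ℕ) (Q : (W.baseChange (v.adicCompletion K)).toAffine.Point),
        p ^ j • Q = 0 → p ^ e • Q = 0) :
    Subsingleton (galoisCohomology (LocBridge.primaryGaloisModule W p) 2) := by
  haveI := finite_galoisCohomology_two_primary_anyTorsion W p 𝔭 S hPT htor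
  choose n hn using exists_pow_smul_eq_zero W p
  haveI := Fintype.ofFinite (galoisCohomology (LocBridge.primaryGaloisModule W p) 2)
  have hexp : ∀ Z : galoisCohomology (LocBridge.primaryGaloisModule W p) 2,
      p ^ (Finset.univ.sup n) • Z = 0 := fun Z ↦ by
    have hle : n Z ≤ Finset.univ.sup n := Finset.le_sup (Finset.mem_univ Z)
    rw [← Nat.sub_add_cancel hle, pow_add, mul_smul, hn, smul_zero]
  have hiter : ∀ (m : ℕ) (Z : galoisCohomology (LocBridge.primaryGaloisModule W p) 2),
      ∃ Y : galoisCohomology (LocBridge.primaryGaloisModule W p) 2, p ^ m • Y = Z := by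
    intro m
    induction m with
    | zero => exact fun Z ↦ ⟨Z, by rw [pow_zero, one_smul]⟩
    | succ m ih =>
      intro Z
      obtain ⟨Y, rfl⟩ := ih Z
      obtain ⟨Y', rfl⟩ := exists_smul_eq W p hcd Y
      exact ⟨Y', by rw [pow_succ, mul_smul]⟩
  refine ⟨fun Z Z' ↦ ?_⟩
  obtain ⟨Y, rfl⟩ := hiter (Finset.univ.sup n) Z
  obtain ⟨Y', rfl⟩ := hiter (Finset.univ.sup n) Z'
  rw [hexp, hexp]

end Main

end Summit.BirchSwinnertonDyer.BirchSwinnertonDyer.Theorems.SchneiderFreeAdditiveX3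

end
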